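import Literature.AlgebraicGeometry.Motives.FermatHypersurface
import Literature.AlgebraicGeometry.HodgeTheory.BettiUniverseTracePairing
import Literature.AlgebraicGeometry.HodgeTheory.DiagonalSymmetryStability
import HarnessLib

/-!
# The involution of a hypersurface cut out by a sign-symmetric form, and its sign deck on cohomology

Family `hodge`, layer `Literature/AlgebraicGeometry/HodgeTheory`. Written by the cross-ladder
literature-typing seat `littype-FH1-2` (cell `hodge-nonav`) for crux K1
`VeryGeneralSignCommutatorsInHg` of the route `HodgeConjecture/SignSymmetricPowers`, whose typed
statement asks, for every smooth projective threefold `X` CUT OUT in `ℙ⁴` by an `ι`-even quinary form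
`f` (`Motives.IsHypersurfaceCutOutBy 4 f X`, `ι = diag(−1,−1,1,1,1)`, "every monomial of even degree
in `x₀, x₁`": `∀ e, ¬ Even (e 0 + e 1) → f.coeff e = 0`), for a morphism `σ : X ⟶ X` with
(i) `pull σ 3 ^ 2 = 1` and (ii) `tr hX (3 + 3) (cup X 3 3 (pull σ 3 x) (pull σ 3 y)) = tr hX (3 + 3) (cup X 3 3 x y)`
(the first two clauses of its "sign deck"; the route item records "as TYPED `σ = ι|_X` must exist on every
abstract `X` cut out by `f`" among the things that might fail). This file constructs that `σ` and
proves (i)–(ii), for every field, every dimension and every diagonal sign symmetry.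

Printed context: the involution `ι|_X` of a hypersurface invariant under a linear involution and its
`±1`-eigenspaces on the middle cohomology are the objects of Voisin, *Sur l'application d'Abel–Jacobi
des variétés de Calabi–Yau de dimension trois*, Ann. Sci. ENS 27 (1994) / ASNSP 19 (1992) Lemme 2.19
(`ι`-invariant quintic threefolds) and Bardelli, Crelle 422 (1991) §3 (`(2,2,2,2) ⊂ ℙ⁷` with
`σ(x, y) = (x, −y)`); the construction itself is Hartshorne II Example 7.1.1 (a linear change of
coordinates is an automorphism of `ℙⁿ`) with II Ex. 3.11 (d) (it restricts to the reduced induced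
structure on an invariant closed subset), exactly as the tree does it for the Dwork pencil
(`Motives/DworkFamily`: `ProjectiveSpace.diagMap`, `SmoothHypersurface.substLift`) and for diagonal
symmetries over `ℂ` (`HodgeTheory/DiagonalSymmetry.diagonalAut`).

## Contents (everything PROVED; one plumbing definition `signVector`; no named fact — D-0026)

§1 **Invariance of a form under a diagonal substitution is a condition on coefficients** (any
   commutative ring / field `k`, `ζ : Fin (m+1) → k`, `σ_ζ : xⱼ ↦ ζⱼ xⱼ` the tree's
   `ProjectiveSpace.diagSubst`): `σ_ζ(monomial e c) = monomial e (c ∏ ζⱼ^{eⱼ})`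
   (`aeval_diagSubst_monomial`), `coeff e (σ_ζ F) = (∏ ζⱼ^{eⱼ}) coeff e F` (`coeff_aeval_diagSubst`),
   `σ_ζ F = F ↔ ∀ e, (∏ ζⱼ^{eⱼ}) coeff e F = coeff e F` (`aeval_diagSubst_eq_self_iff`). For the SIGN
   vector `signVector k a = (−1, …, −1, 1, …, 1)` (`a` minus signs): `∏ⱼ (signVector k a j)^{eⱼ} = (−1)^{Σ_{j<a} eⱼ}`
   (`prod_signVector_pow`), so a form all of whose monomials have `Σ_{j<a} eⱼ` even is invariant
   (`aeval_diagSubst_signVector_eq_self`); the route's literal hypothesis on quinary forms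
   (`a = 2`: `¬ Even (e 0 + e 1) → coeff e f = 0`) is the case `aeval_diagSubst_signVector_two_eq_self`.
§2 **The automorphism of a scheme cut out by an invariant form** (any field `k`): for `F` with
   `σ_ζ F = F`, `ζⱼ ζ'ⱼ = 1`, and ANY `X` with `IsHypersurfaceCutOutBy (n+1) F X` witnessed by a closed
   immersion `ι : X ⟶ ℙⁿ⁺¹` onto `V₊(F)`, there are mutually inverse `σ, σ' : X ⟶ X` over `k` with
   `σ ≫ ι = ι ≫ [z ↦ ζ·z]` (`exists_aut_of_isHypersurfaceCutOutBy`: the tree's `substLift` on the reduced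
   model `X_F`, transported along the unique isomorphism `X ≅ X_F` compatible with the immersions,
   `IsHypersurfaceCutOutBy.exists_iso_comp_eq`); for a sign symmetry (`ζⱼ² = 1`) `σ` is an INVOLUTION,
   `σ ≫ σ = 𝟙 X` (`exists_involution_of_isHypersurfaceCutOutBy`).
§3 **The sign deck, clauses (i)–(ii)** (over `ℂ`, with `BettiUniverseTracePairing`): for `X` smooth
   projective cut out by a sign-symmetric `F`, there is an involution `σ : X ⟶ X` lying over the sign
   change of coordinates with `(σ^*)² = 1` on every `Hᵏ(X(ℂ); ℚ)` and
   `tr(σ^*x ∪ σ^*y) = tr(x ∪ y)` (`exists_involution_deck`); the literal K1 instance for `ι`-even quinary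
   forms and threefolds is `exists_sign_involution_deck_threefold`. Clause (iii) of the deck (the
   eigen-Hodge numbers, Griffiths residues with parity) and the commutator clause are NOT here.
§4 **The CANONICAL deck on the model `X_f = SmoothHypersurface.hypersurface f`** (the shape of the
   registered K1 line `andre-zariski`, stub `stub_signDeckModel`: `σ = diagonalAut f ha` of
   `HodgeTheory/DiagonalSymmetry` for the sign vector of units `i ↦ if i < a then −1 else 1`): the
   route's coefficient hypothesis puts that vector in `diagonalStabilizer f`
   (`signUnits_two_mem_diagonalStabilizer`); `diagonalAut f ha` is an involution
   (`diagonalAut_comp_self_of_mul_self_eq_one`, from the scheme-level group law of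
   `DiagonalSymmetryStability`); hence clauses (i)–(ii) of `Deck` for `σ = diagonalAut f ha`
   (`pull_diagonalAut_sq_eq_one`, `tr_cup_pull_diagonalAut`) and the first two conjuncts of
   `SignDeckModel` verbatim (`exists_signDeckModel_clauses_one_two`).

## References

* [Hartshorne1977] R. Hartshorne, Algebraic Geometry, GTM 52 (1977), II Example 7.1.1, II Ex. 2.14,
  II Ex. 3.11 (d), II Example 3.2.6.
* [Voisin1992Quintic] C. Voisin, Sur l'application d'Abel–Jacobi des variétés de Calabi–Yau de
  dimension trois, Ann. Sc. Norm. Sup. Pisa 19 (1992), Lemme 2.19 (held `paper:url-535f50bdf9aa`, p. 486).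
* [Bardelli1991] F. Bardelli, Crelle 422 (1991) 165–200, §3 (doi:10.1515/crll.1991.422.165).
* [HatcherAT2002] A. Hatcher, Algebraic Topology, CUP 2002, §3.1 p. 198, §3.3 Thm. 3.26, Prop. 3.38.
-/

noncomputable section

open CategoryTheory AlgebraicGeometry MvPolynomial
open Literature.AlgebraicGeometry.Motives

universe u

namespace Literature.AlgebraicGeometry.HodgeTheory

/-! ### §1 Diagonal substitutions on coefficients; sign vectors -/

section Coefficients

variable {k : Type u} [Field k] {m : ℕ}

/-- **`σ_ζ(c x^e) = (∏ ζⱼ^{eⱼ}) c x^e`**: a diagonal substitution rescales each monomial.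
[cite: Hartshorne1977, II Ex. 2.14] -/
theorem aeval_diagSubst_monomial (ζ : Fin (m + 1) → k) (e : Fin (m + 1) →₀ ℕ) (c : k) :
    aeval (ProjectiveSpace.diagSubst ζ) (monomial e c) = monomial e (c * ∏ j, ζ j ^ e j) := by
  rw [aeval_monomial, algebraMap_eq, monomial_eq, ← Finsupp.prod_fintype e (fun j r ↦ ζ j ^ r)
    (fun _ ↦ pow_zero _)]
  have h : (e.prod fun j r ↦ ProjectiveSpace.diagSubst ζ j ^ r) =
      C (e.prod fun j r ↦ ζ j ^ r) * e.prod fun j r ↦ (X j : MvPolynomial (Fin (m + 1)) k) ^ r := by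
    simp only [Finsupp.prod, ProjectiveSpace.diagSubst_apply, mul_pow, Finset.prod_mul_distrib,
      map_prod, map_pow]
  rw [h, ← mul_assoc, ← map_mul]

/-- **`coeff e (σ_ζ F) = (∏ ζⱼ^{eⱼ}) · coeff e F`**. [cite: Hartshorne1977, II Ex. 2.14] -/
theorem coeff_aeval_diagSubst (ζ : Fin (m + 1) → k) (F : MvPolynomial (Fin (m + 1)) k)
    (e : Fin (m + 1) →₀ ℕ) :
    coeff e (aeval (ProjectiveSpace.diagSubst ζ) F) = (∏ j, ζ j ^ e j) * coeff e F := by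
  conv_lhs => rw [F.as_sum, map_sum]
  simp_rw [aeval_diagSubst_monomial, coeff_sum, coeff_monomial]
  rw [Finset.sum_ite_eq']
  split_ifs with he
  · rw [mul_comm]
  · rw [notMem_support_iff.mp he, mul_zero]

/-- **Invariance under `σ_ζ` is a condition on coefficients**: `σ_ζ F = F` iff
`(∏ ζⱼ^{eⱼ}) coeff e F = coeff e F` for every exponent `e`. [cite: Hartshorne1977, II Ex. 2.14] -/
theorem aeval_diagSubst_eq_self_iff (ζ : Fin (m + 1) → k) (F : MvPolynomial (Fin (m + 1)) k) :
    aeval (ProjectiveSpace.diagSubst ζ) F = F ↔ ∀ e, (∏ j, ζ j ^ e j) * coeff e F = coeff e F := by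
  rw [MvPolynomial.ext_iff]
  exact forall_congr' fun e ↦ by rw [coeff_aeval_diagSubst]

/-- If every monomial of `F` with `∏ ζⱼ^{eⱼ} ≠ 1` has coefficient zero then `σ_ζ F = F`.
[cite: Hartshorne1977, II Ex. 2.14] -/
theorem aeval_diagSubst_eq_self_of_coeff_eq_zero (ζ : Fin (m + 1) → k) (F : MvPolynomial (Fin (m + 1)) k)
    (hF : ∀ e : Fin (m + 1) →₀ ℕ, (∏ j, ζ j ^ e j) ≠ 1 → coeff e F = 0) :
    aeval (ProjectiveSpace.diagSubst ζ) F = F := by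
  rw [aeval_diagSubst_eq_self_iff]
  intro e
  by_cases h : (∏ j, ζ j ^ e j) = 1
  · rw [h, one_mul]
  · rw [hF e h, mul_zero]

variable (k) in
/-- The **sign vector** `(−1, …, −1, 1, …, 1)` with `a` minus signs in front: the diagonal of the
linear involution `ι = diag(−1^{(a)}, 1^{(b)})` of `kᵃ⁺ᵇ` (the route's `ι = diag(−1,−1,1,1,1)` is
`a = 2` on `Fin 5`). [cite: Hartshorne1977, II Example 7.1.1] -/
def signVector {N : ℕ} (a : ℕ) : Fin N → k := fun j ↦ if (j : ℕ) < a then -1 else 1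

/-- Unfolding of the sign vector of `ι = diag(−1^{(a)}, 1^{(b)})`. [cite: Hartshorne1977, II Example 7.1.1] -/
theorem signVector_apply {N : ℕ} (a : ℕ) (j : Fin N) :
    signVector k a j = if (j : ℕ) < a then -1 else 1 := rfl

/-- A sign vector is an involution: `ζⱼ ζⱼ = 1` (so `diag(ζ)` is an involution of `ℙⁿ`). [cite: Hartshorne1977, II Example 7.1.1] -/
theorem signVector_mul_self {N : ℕ} (a : ℕ) (j : Fin N) : signVector k a j * signVector k a j = 1 := by
  rw [signVector_apply]
  split_ifs <;> simp

/-- `∏ⱼ ζⱼ^{eⱼ} = (−1)^{Σ_{j<a} eⱼ}` for the sign vector: the character by which `diag(ζ)` acts on the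
monomial `x^e`. [cite: Hartshorne1977, II Ex. 2.14] -/
theorem prod_signVector_pow (a : ℕ) (e : Fin (m + 1) →₀ ℕ) :
    (∏ j, signVector k a j ^ e j) = (-1) ^ (∑ j ∈ Finset.univ.filter (fun j : Fin (m + 1) ↦ (j : ℕ) < a), e j) := by
  rw [← Finset.prod_pow_eq_pow_sum, Finset.prod_filter]
  refine Finset.prod_congr rfl fun j _ ↦ ?_
  rw [signVector_apply]
  split_ifs <;> simp

/-- **A form whose monomials all have even partial degree `Σ_{j<a} eⱼ` is invariant under the sign
substitution `xⱼ ↦ −xⱼ (j < a)`.** [cite: Hartshorne1977, II Ex. 2.14] -/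
theorem aeval_diagSubst_signVector_eq_self (a : ℕ) (F : MvPolynomial (Fin (m + 1)) k)
    (hF : ∀ e : Fin (m + 1) →₀ ℕ,
      ¬ Even (∑ j ∈ Finset.univ.filter (fun j : Fin (m + 1) ↦ (j : ℕ) < a), e j) → coeff e F = 0) :
    aeval (ProjectiveSpace.diagSubst (signVector k a)) F = F := by
  refine aeval_diagSubst_eq_self_of_coeff_eq_zero _ F fun e he ↦ hF e fun hev ↦ he ?_
  rw [prod_signVector_pow, hev.neg_one_pow]

/-- **The route's hypothesis**: a quinary form with `coeff e f = 0` whenever `e₀ + e₁` is odd is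
invariant under `ι = diag(−1,−1,1,1,1)`, i.e. `f(−x₀, −x₁, x₂, x₃, x₄) = f`. [cite: Hartshorne1977, II Ex. 2.14] -/
theorem aeval_diagSubst_signVector_two_eq_self (f : MvPolynomial (Fin 5) k)
    (hf : ∀ e : Fin 5 →₀ ℕ, ¬ Even (e 0 + e 1) → coeff e f = 0) :
    aeval (ProjectiveSpace.diagSubst (signVector k 2 : Fin 5 → k)) f = f := by
  refine aeval_diagSubst_signVector_eq_self (m := 4) 2 f fun e he ↦ hf e ?_
  have h : (∑ j ∈ Finset.univ.filter (fun j : Fin (4 + 1) ↦ (j : ℕ) < 2), e j) = e 0 + e 1 := by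
    have hs : Finset.univ.filter (fun j : Fin (4 + 1) ↦ (j : ℕ) < 2) = {0, 1} := by decide
    rw [hs, Finset.sum_pair (by decide)]
  rwa [h] at he

end Coefficients

/-! ### §2 The automorphism of a scheme cut out by an invariant form -/

section Automorphism

variable {k : Type u} [Field k] {n : ℕ}

/-- **The automorphism induced on ANY scheme cut out by an invariant form.** Let `F` be a form in
`n + 2` variables fixed by the diagonal substitution `σ_ζ` (`ζⱼ ζ'ⱼ = 1`), and let `X` be cut out by `F`
(`IsHypersurfaceCutOutBy (n+1) F X`) with a closed immersion `ι : X ⟶ ℙⁿ⁺¹_k` onto `V₊(F)`. Then there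
are `σ σ' : X ⟶ X` over `k`, mutually inverse, with `σ ≫ ι = ι ≫ [z ↦ ζ·z]` and
`σ' ≫ ι = ι ≫ [z ↦ ζ'·z]` (the tree's `SmoothHypersurface.substLift` on the reduced model `X_F`,
Hartshorne II 7.1.1 + II Ex. 3.11 (d), transported along the isomorphism `X ≅ X_F` compatible with
the immersions). [cite: Hartshorne1977, II Example 7.1.1 and II Ex. 3.11 (d)] -/
theorem exists_aut_of_isHypersurfaceCutOutBy {F : MvPolynomial (Fin (n + 2)) k} {ζ ζ' : Fin (n + 2) → k}
    (hζ : ∀ j, ζ j * ζ' j = 1) (hF : aeval (ProjectiveSpace.diagSubst ζ) F = F)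
    (hF' : aeval (ProjectiveSpace.diagSubst ζ') F = F) {X : SchemeOver k}
    (h : IsHypersurfaceCutOutBy (n + 1) F X) (ι : X ⟶ projectiveSpace (n + 1) k)
    [IsClosedImmersion ι.left]
    (hι : letI := MvPolynomial.gradedAlgebra (σ := Fin (n + 2)) (R := k);
      Set.range ι.left.base =
        ProjectiveSpectrum.zeroLocus (MvPolynomial.homogeneousSubmodule (Fin (n + 2)) k) {F}) :
    ∃ σ σ' : X ⟶ X, σ ≫ σ' = 𝟙 X ∧ σ' ≫ σ = 𝟙 X ∧
      σ ≫ ι = ι ≫ ProjectiveSpace.substMap (ProjectiveSpace.diagSubst ζ)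
        (ProjectiveSpace.isHomogeneous_diagSubst ζ) (ProjectiveSpace.diagSubst ζ')
        (ProjectiveSpace.isHomogeneous_diagSubst ζ') (ProjectiveSpace.aeval_diagSubst_diagSubst hζ) ∧
      σ' ≫ ι = ι ≫ ProjectiveSpace.substMap (ProjectiveSpace.diagSubst ζ')
        (ProjectiveSpace.isHomogeneous_diagSubst ζ') (ProjectiveSpace.diagSubst ζ)
        (ProjectiveSpace.isHomogeneous_diagSubst ζ)
        (ProjectiveSpace.aeval_diagSubst_diagSubst fun j ↦ by rw [mul_comm]; exact hζ j) := by
  have hζ' : ∀ j, ζ' j * ζ j = 1 := fun j ↦ by rw [mul_comm]; exact hζ j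
  set τ := ProjectiveSpace.diagSubst ζ
  set τ' := ProjectiveSpace.diagSubst ζ'
  have hτ := ProjectiveSpace.isHomogeneous_diagSubst ζ
  have hτ' := ProjectiveSpace.isHomogeneous_diagSubst ζ'
  have hinv : ∀ p, aeval τ (aeval τ' p) = p := ProjectiveSpace.aeval_diagSubst_diagSubst hζ
  have hinv' : ∀ p, aeval τ' (aeval τ p) = p := ProjectiveSpace.aeval_diagSubst_diagSubst hζ'
  -- the model automorphisms
  set σ₀ := SmoothHypersurface.substLift F τ hτ τ' hτ' hinv hF with hσ₀
  set σ₀' := SmoothHypersurface.substLift F τ' hτ' τ hτ hinv' hF' with hσ₀'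
  -- the compatible isomorphism `X ≅ X_F`
  obtain ⟨e, he⟩ := h.exists_iso_comp_eq (SmoothHypersurface.isHypersurfaceCutOutBy_self F) ι hι
    (SmoothHypersurface.hypersurfaceι F) (SmoothHypersurface.range_hypersurfaceι F)
  have he' : e.inv ≫ ι = SmoothHypersurface.hypersurfaceι F := by
    rw [← he, Iso.inv_hom_id_assoc]
  refine ⟨e.hom ≫ σ₀ ≫ e.inv, e.hom ≫ σ₀' ≫ e.inv, ?_, ?_, ?_, ?_⟩
  · rw [Category.assoc, Category.assoc, Iso.inv_hom_id_assoc, ← Category.assoc σ₀,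
      SmoothHypersurface.substLift_comp_substLift F τ hτ τ' hτ' hinv hF hinv' hF', Category.id_comp,
      Iso.hom_inv_id]
  · rw [Category.assoc, Category.assoc, Iso.inv_hom_id_assoc, ← Category.assoc σ₀',
      SmoothHypersurface.substLift_comp_substLift F τ' hτ' τ hτ hinv' hF' hinv hF, Category.id_comp,
      Iso.hom_inv_id]
  · rw [Category.assoc, Category.assoc, he', SmoothHypersurface.substLift_comp_hypersurfaceι,
      ← Category.assoc, he]
  · rw [Category.assoc, Category.assoc, he', SmoothHypersurface.substLift_comp_hypersurfaceι,
      ← Category.assoc, he]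

/-- **The involution of a scheme cut out by a sign-symmetric form.** For `ζ` with `ζⱼ² = 1` and `F`
with `σ_ζ F = F`, every `X` cut out by `F`, with closed immersion `ι : X ⟶ ℙⁿ⁺¹_k` onto `V₊(F)`,
carries `σ : X ⟶ X` over `k` with `σ ≫ σ = 𝟙 X` and `σ ≫ ι = ι ≫ [z ↦ ζ·z]`.
[cite: Hartshorne1977, II Example 7.1.1 and II Ex. 3.11 (d)] -/
theorem exists_involution_of_isHypersurfaceCutOutBy {F : MvPolynomial (Fin (n + 2)) k}
    {ζ : Fin (n + 2) → k} (hζ : ∀ j, ζ j * ζ j = 1) (hF : aeval (ProjectiveSpace.diagSubst ζ) F = F)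
    {X : SchemeOver k} (h : IsHypersurfaceCutOutBy (n + 1) F X) (ι : X ⟶ projectiveSpace (n + 1) k)
    [IsClosedImmersion ι.left]
    (hι : letI := MvPolynomial.gradedAlgebra (σ := Fin (n + 2)) (R := k);
      Set.range ι.left.base =
        ProjectiveSpectrum.zeroLocus (MvPolynomial.homogeneousSubmodule (Fin (n + 2)) k) {F}) :
    ∃ σ : X ⟶ X, σ ≫ σ = 𝟙 X ∧
      σ ≫ ι = ι ≫ ProjectiveSpace.substMap (ProjectiveSpace.diagSubst ζ)
        (ProjectiveSpace.isHomogeneous_diagSubst ζ) (ProjectiveSpace.diagSubst ζ)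
        (ProjectiveSpace.isHomogeneous_diagSubst ζ) (ProjectiveSpace.aeval_diagSubst_diagSubst hζ) := by
  set τ := ProjectiveSpace.diagSubst ζ
  have hτ := ProjectiveSpace.isHomogeneous_diagSubst ζ
  have hinv : ∀ p, aeval τ (aeval τ p) = p := ProjectiveSpace.aeval_diagSubst_diagSubst hζ
  set σ₀ := SmoothHypersurface.substLift F τ hτ τ hτ hinv hF with hσ₀
  obtain ⟨e, he⟩ := h.exists_iso_comp_eq (SmoothHypersurface.isHypersurfaceCutOutBy_self F) ι hι
    (SmoothHypersurface.hypersurfaceι F) (SmoothHypersurface.range_hypersurfaceι F)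
  have he' : e.inv ≫ ι = SmoothHypersurface.hypersurfaceι F := by
    rw [← he, Iso.inv_hom_id_assoc]
  refine ⟨e.hom ≫ σ₀ ≫ e.inv, ?_, ?_⟩
  · rw [Category.assoc, Category.assoc, Iso.inv_hom_id_assoc, ← Category.assoc σ₀,
      SmoothHypersurface.substLift_comp_substLift F τ hτ τ hτ hinv hF hinv hF, Category.id_comp,
      Iso.hom_inv_id]
  · rw [Category.assoc, Category.assoc, he', SmoothHypersurface.substLift_comp_hypersurfaceι,
      ← Category.assoc, he]

/-- The immersion-free form: every `X` cut out by a sign-symmetric form carries an involution over `k`.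
[cite: Hartshorne1977, II Example 7.1.1 and II Ex. 3.11 (d)] -/
theorem exists_involution_of_isHypersurfaceCutOutBy' {F : MvPolynomial (Fin (n + 2)) k}
    {ζ : Fin (n + 2) → k} (hζ : ∀ j, ζ j * ζ j = 1) (hF : aeval (ProjectiveSpace.diagSubst ζ) F = F)
    {X : SchemeOver k} (h : IsHypersurfaceCutOutBy (n + 1) F X) :
    ∃ σ : X ⟶ X, σ ≫ σ = 𝟙 X := by
  obtain ⟨ι, hιc, hι⟩ := h.2
  haveI := hιc
  obtain ⟨σ, hσ, -⟩ := exists_involution_of_isHypersurfaceCutOutBy hζ hF h ι hι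
  exact ⟨σ, hσ⟩

end Automorphism

/-! ### §3 The sign deck on cohomology (over `ℂ`) -/

section HodgeTheory

variable {n d : ℕ} {X : SchemeOver ℂ}

/-- **The sign deck, clauses (i)–(ii), for a smooth projective variety cut out by a sign-symmetric
form.** For `ζⱼ² = 1`, `σ_ζ F = F`, `X` smooth projective of dimension `d` over `ℂ` cut out by `F` with
immersion `ι` onto `V₊(F)`: there is an involution `σ : X ⟶ X` over `ℂ`, lying over `[z ↦ ζ·z]`, with
`(σ^*)² = 1` on `Hᵏ(X(ℂ); ℚ)` and `tr(σ^*x ∪ σ^*y) = tr(x ∪ y)` for all `x, y ∈ Hᵏ(X(ℂ); ℚ)` (the light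
trace pairing of `BettiUniverseAxioms`; `BettiUniverse.pull_sq_eq_one_of_comp_self_eq_id`,
`BettiUniverse.tr_cup_pull_pull`). [cite: Hartshorne1977, II Example 7.1.1 and II Ex. 3.11 (d)]
[cite: HatcherAT2002, §3.3 Thm. 3.26 and Prop. 3.38] -/
theorem exists_involution_deck {F : MvPolynomial (Fin (n + 2)) ℂ} {ζ : Fin (n + 2) → ℂ}
    (hζ : ∀ j, ζ j * ζ j = 1) (hF : aeval (ProjectiveSpace.diagSubst ζ) F = F)
    (hX : IsSmoothProjective d X) (h : IsHypersurfaceCutOutBy (n + 1) F X)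
    (ι : X ⟶ projectiveSpace (n + 1) ℂ) [IsClosedImmersion ι.left]
    (hι : letI := MvPolynomial.gradedAlgebra (σ := Fin (n + 2)) (R := ℂ);
      Set.range ι.left.base =
        ProjectiveSpectrum.zeroLocus (MvPolynomial.homogeneousSubmodule (Fin (n + 2)) ℂ) {F}) (k : ℕ) :
    ∃ σ : X ⟶ X, σ ≫ σ = 𝟙 X ∧
      σ ≫ ι = ι ≫ ProjectiveSpace.substMap (ProjectiveSpace.diagSubst ζ)
        (ProjectiveSpace.isHomogeneous_diagSubst ζ) (ProjectiveSpace.diagSubst ζ)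
        (ProjectiveSpace.isHomogeneous_diagSubst ζ) (ProjectiveSpace.aeval_diagSubst_diagSubst hζ) ∧
      BettiUniverse.pull σ k ^ 2 = 1 ∧
      ∀ x y : bettiCohomology X k,
        BettiUniverse.tr hX (k + k) (BettiUniverse.cup X k k (BettiUniverse.pull σ k x)
          (BettiUniverse.pull σ k y)) = BettiUniverse.tr hX (k + k) (BettiUniverse.cup X k k x y) := by
  obtain ⟨σ, hσ, hσι⟩ := exists_involution_of_isHypersurfaceCutOutBy hζ hF h ι hι
  exact ⟨σ, hσ, hσι, BettiUniverse.pull_sq_eq_one_of_comp_self_eq_id hσ k,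
    BettiUniverse.tr_cup_pull_pull hX hσ k k⟩

/-- **The K1 instance: the sign involution of a threefold cut out by an `ι`-even quinary form and its
deck clauses (i)–(ii).** For `f ∈ ℂ[x₀, …, x₄]` with `coeff e f = 0` whenever `e₀ + e₁` is odd and a
smooth projective threefold `X` cut out in `ℙ⁴` by `f` (`IsHypersurfaceCutOutBy 4 f X`), there is
`σ : X ⟶ X` with `σ ≫ σ = 𝟙 X`, `pull σ 3 ^ 2 = 1`,
`tr hX (3 + 3) (cup X 3 3 (pull σ 3 x) (pull σ 3 y)) = tr hX (3 + 3) (cup X 3 3 x y)`, and which is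
`ι|_X`: for some closed immersion `ι : X ⟶ ℙ⁴` onto `V₊(f)`, `σ ≫ ι = ι ≫ diag(−1,−1,1,1,1)`.
(Clause (iii) — the eigen-Hodge numbers — and the commutator clause of
`SignSymmetricPowers.VeryGeneralSignCommutatorsInHg` are not addressed here.)
[cite: Hartshorne1977, II Example 7.1.1 and II Ex. 3.11 (d)] [cite: HatcherAT2002, §3.3 Thm. 3.26 and Prop. 3.38] -/
theorem exists_sign_involution_deck_threefold (f : MvPolynomial (Fin 5) ℂ)
    (hf : ∀ e : Fin 5 →₀ ℕ, ¬ Even (e 0 + e 1) → f.coeff e = 0)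
    (hX : IsSmoothProjective 3 X) (hcut : IsHypersurfaceCutOutBy 4 f X) :
    ∃ σ : X ⟶ X, σ ≫ σ = 𝟙 X ∧ BettiUniverse.pull σ 3 ^ 2 = 1 ∧
      (∀ x y : bettiCohomology X 3,
        BettiUniverse.tr hX (3 + 3) (BettiUniverse.cup X 3 3 (BettiUniverse.pull σ 3 x)
          (BettiUniverse.pull σ 3 y)) = BettiUniverse.tr hX (3 + 3) (BettiUniverse.cup X 3 3 x y)) ∧
      ∃ (ι : X ⟶ projectiveSpace 4 ℂ) (_ : IsClosedImmersion ι.left),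
        (letI := MvPolynomial.gradedAlgebra (σ := Fin 5) (R := ℂ);
          Set.range ι.left.base =
            ProjectiveSpectrum.zeroLocus (MvPolynomial.homogeneousSubmodule (Fin 5) ℂ) {f}) ∧
        σ ≫ ι = ι ≫ ProjectiveSpace.substMap (ProjectiveSpace.diagSubst (signVector ℂ 2))
          (ProjectiveSpace.isHomogeneous_diagSubst _) (ProjectiveSpace.diagSubst (signVector ℂ 2))
          (ProjectiveSpace.isHomogeneous_diagSubst _)
          (ProjectiveSpace.aeval_diagSubst_diagSubst (signVector_mul_self (k := ℂ) 2)) := by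
  obtain ⟨ι, hιc, hι⟩ := hcut.2
  haveI := hιc
  have hF := aeval_diagSubst_signVector_two_eq_self (k := ℂ) f hf
  obtain ⟨σ, hσ, hσι, hsq, htr⟩ := exists_involution_deck (n := 3) (signVector_mul_self (k := ℂ) 2)
    hF hX hcut ι hι 3
  exact ⟨σ, hσ, hsq, htr, ι, hιc, hι, hσι⟩

end HodgeTheory

/-! ### §4 The canonical deck `σ = diagonalAut f ha` on the model hypersurface -/

section ModelDeck

variable {n : ℕ}

/-- The sign vector of UNITS `i ↦ if i < a then −1 else 1` (the spelling of the K1 line) has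
underlying scalars the `signVector`. [cite: Hartshorne1977, II Example 7.1.1] -/
theorem coe_signUnits_apply {N : ℕ} (a : ℕ) (i : Fin N) :
    (((fun i : Fin N ↦ if (i : ℕ) < a then (-1 : ℂˣ) else 1) i : ℂˣ) : ℂ) = signVector ℂ a i := by
  rw [signVector_apply]
  dsimp only
  split_ifs <;> simp

/-- The diagonal substitution of the sign vector of units is `diagSubst (signVector ℂ a)`
(`HodgeTheory.diagonalSubst` and `ProjectiveSpace.diagSubst` agree on scalars).
[cite: Hartshorne1977, II Example 7.1.1] -/
theorem diagonalSubst_signUnits (a : ℕ) :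
    diagonalSubst (fun i : Fin (n + 2) ↦ if (i : ℕ) < a then (-1 : ℂˣ) else 1) =
      ProjectiveSpace.diagSubst (signVector ℂ a) := by
  funext i
  rw [diagonalSubst_apply, ProjectiveSpace.diagSubst_apply, coe_signUnits_apply]

/-- The sign vector of units squares to `1`. [cite: Hartshorne1977, II Example 7.1.1] -/
theorem signUnits_mul_self {N : ℕ} (a : ℕ) :
    (fun i : Fin N ↦ if (i : ℕ) < a then (-1 : ℂˣ) else 1) *
      (fun i : Fin N ↦ if (i : ℕ) < a then (-1 : ℂˣ) else 1) = 1 := by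
  funext i
  simp only [Pi.mul_apply, Pi.one_apply]
  split_ifs <;> simp

/-- **A form with all monomials of even partial degree `Σ_{j<a} eⱼ` has the sign vector of units in
its diagonal stabiliser** (`DiagonalSymmetry.diagonalStabilizer`). [cite: Hartshorne1977, II Ex. 2.14] -/
theorem signUnits_mem_diagonalStabilizer_of_coeff (a : ℕ) (F : MvPolynomial (Fin (n + 2)) ℂ)
    (hF : ∀ e : Fin (n + 2) →₀ ℕ,
      ¬ Even (∑ j ∈ Finset.univ.filter (fun j : Fin (n + 2) ↦ (j : ℕ) < a), e j) → coeff e F = 0) :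
    (fun i : Fin (n + 2) ↦ if (i : ℕ) < a then (-1 : ℂˣ) else 1) ∈ diagonalStabilizer F := by
  rw [mem_diagonalStabilizer_iff, diagonalSubst_signUnits]
  exact aeval_diagSubst_signVector_eq_self a F hF

/-- **The route's `ι = diag(−1,−1,1,1,1)` stabilises every `ι`-even quinary form** (the membership
`ha` of the K1 line `andre-zariski`, `stub_signDeckModel`). [cite: Hartshorne1977, II Ex. 2.14] -/
theorem signUnits_two_mem_diagonalStabilizer (f : MvPolynomial (Fin 5) ℂ)
    (hf : ∀ e : Fin 5 →₀ ℕ, ¬ Even (e 0 + e 1) → f.coeff e = 0) :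
    (fun i : Fin 5 ↦ if (i : ℕ) < 2 then (-1 : ℂˣ) else 1) ∈ diagonalStabilizer f := by
  rw [mem_diagonalStabilizer_iff, diagonalSubst_signUnits (n := 3) 2]
  exact aeval_diagSubst_signVector_two_eq_self f hf

/-- **A sign symmetry gives an algebraic involution of the model**: for `a² = 1` in the diagonal
stabiliser, `diagonalAut F ha ≫ diagonalAut F ha = 𝟙 X_F` (the scheme-level group law
`diagonalAut_left_mul`, `diagonalAut_left_one` of `DiagonalSymmetryStability`; two `Over`-morphisms
with equal underlying maps agree). [cite: Katz2009, §3] [cite: Hartshorne1977, II Example 7.1.1] -/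
theorem diagonalAut_comp_self_of_mul_self_eq_one (F : MvPolynomial (Fin (n + 2)) ℂ)
    {a : Fin (n + 2) → ℂˣ} (ha : a ∈ diagonalStabilizer F) (h : a * a = 1) :
    diagonalAut F ha ≫ diagonalAut F ha = 𝟙 _ := by
  have hmul : diagonalAut F (mul_mem ha ha) = diagonalAut F (one_mem (diagonalStabilizer F)) := by
    congr 1
  refine Over.OverMorphism.ext ?_
  rw [Over.comp_left, Over.id_left, ← diagonalAut_left_mul, hmul, diagonalAut_left_one]

/-- **Deck clause (i) for the canonical deck**: `(σ^*)² = 1` on `Hᵏ(X_F(ℂ); ℚ)` for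
`σ = diagonalAut F ha`, `a² = 1`. [cite: HatcherAT2002, §3.1 p. 198] -/
theorem pull_diagonalAut_sq_eq_one (F : MvPolynomial (Fin (n + 2)) ℂ) {a : Fin (n + 2) → ℂˣ}
    (ha : a ∈ diagonalStabilizer F) (h : a * a = 1) (k : ℕ) :
    BettiUniverse.pull (diagonalAut F ha) k ^ 2 = 1 :=
  BettiUniverse.pull_sq_eq_one_of_comp_self_eq_id (diagonalAut_comp_self_of_mul_self_eq_one F ha h) k

/-- **Deck clause (ii) for the canonical deck**: every diagonal symmetry of a smooth projective
model `X_F` is an isometry of the light trace pairing, `tr(σ^*x ∪ σ^*y) = tr(x ∪ y)` (it is an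
automorphism, `isIso_diagonalAut_left`, and automorphisms fix the trace, `BettiUniverseTracePairing`).
[cite: HatcherAT2002, §3.3 Thm. 3.26 and §3.2 Prop. 3.10] [cite: Fulton1998, Lemma 19.1.2 and §1.4] -/
theorem tr_cup_pull_diagonalAut {d : ℕ} (F : MvPolynomial (Fin (n + 2)) ℂ) {a : Fin (n + 2) → ℂˣ}
    (hX : IsSmoothProjective d (SmoothHypersurface.hypersurface F)) (ha : a ∈ diagonalStabilizer F)
    (i j : ℕ) (x : bettiCohomology (SmoothHypersurface.hypersurface F) i)
    (y : bettiCohomology (SmoothHypersurface.hypersurface F) j) :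
    BettiUniverse.tr hX (i + j) (BettiUniverse.cup _ i j (BettiUniverse.pull (diagonalAut F ha) i x)
        (BettiUniverse.pull (diagonalAut F ha) j y)) =
      BettiUniverse.tr hX (i + j) (BettiUniverse.cup _ i j x y) :=
  BettiUniverse.tr_cup_pull_pull_of_isIso hX (diagonalAut F ha) i j x y

/-- **The first two conjuncts of `SignDeckModel` (K1 line `andre-zariski`, stub
`stub_signDeckModel`), verbatim**: for an `ι`-even quinary form `f` with smooth projective model
`X_f = SmoothHypersurface.hypersurface f`, the sign vector `ι = diag(−1,−1,1,1,1)` lies in the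
diagonal stabiliser of `f` and the canonical deck `σ = diagonalAut f ha` satisfies
`pull σ 3 ^ 2 = 1` and `tr hXF (3 + 3) (cup X_f 3 3 (pull σ 3 x) (pull σ 3 y)) = tr hXF (3 + 3) (cup X_f 3 3 x y)`.
(The third conjunct — the eigen-Hodge numbers `shn d j q` — is not addressed here.)
[cite: Hartshorne1977, II Example 7.1.1 and II Ex. 2.14] [cite: HatcherAT2002, §3.3 Thm. 3.26 and Prop. 3.38] -/
theorem exists_signDeckModel_clauses_one_two (f : MvPolynomial (Fin 5) ℂ)
    (hf : ∀ e : Fin 5 →₀ ℕ, ¬ Even (e 0 + e 1) → f.coeff e = 0)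
    (hXF : IsSmoothProjective 3 (SmoothHypersurface.hypersurface f)) :
    ∃ ha : (fun i : Fin 5 ↦ if (i : ℕ) < 2 then (-1 : ℂˣ) else 1) ∈ diagonalStabilizer f,
      BettiUniverse.pull (diagonalAut f ha) 3 ^ 2 = 1 ∧
      ∀ x y : bettiCohomology (SmoothHypersurface.hypersurface f) 3,
        BettiUniverse.tr hXF (3 + 3) (BettiUniverse.cup (SmoothHypersurface.hypersurface f) 3 3
          (BettiUniverse.pull (diagonalAut f ha) 3 x) (BettiUniverse.pull (diagonalAut f ha) 3 y)) =
        BettiUniverse.tr hXF (3 + 3) (BettiUniverse.cup (SmoothHypersurface.hypersurface f) 3 3 x y) :=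
  ⟨signUnits_two_mem_diagonalStabilizer f hf,
    pull_diagonalAut_sq_eq_one (n := 3) f _ (signUnits_mul_self 2) 3,
    fun x y ↦ tr_cup_pull_diagonalAut (n := 3) f hXF _ 3 3 x y⟩

end ModelDeck

end Literature.AlgebraicGeometry.HodgeTheory

end
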